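import Literature.NumberTheory.Rogawski1990.ArchBouazizStableFamilyJumpZeroBinder    -- ★ p850457 (this seat): (K0H-BINDER); brings ★ p850334∕p850206, (P1)∕(P4), (T-CONGR), (I₂@cayPt)
import Literature.NumberTheory.Rogawski1990.ArchBouazizStableFamilyCayleyRay       -- ★ p850429 (LH1-p04): (V1-H) ray value ∕ non-vanishing under membership
import Literature.NumberTheory.Rogawski1990.ArchEndoscopicProductTestFunction      -- ★ p850361 (LH2-p04): (N1) product test functions with prescribed positive local factors
import Literature.NumberTheory.Rogawski1990.ArchJumpAgreementOfBricks              -- ★ p850355 (LH4-p03): `HcSemireg`, `hcSemireg_zero_two_hreg`, `IsCoveredWall`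
import Literature.NumberTheory.Automorphic.UnitaryFormGroupTestFunctionExtension    -- ★ p850450 (this seat): (EXT) `exists_hasCompactSupport_extend`
import Literature.NumberTheory.Automorphic.ArchEndoscopicChartSplitDock             -- ★ p850300 (LH3-p01): (DOCK-w₀)
import Literature.NumberTheory.Automorphic.ArchEndoscopicChartOrbLocalPos           -- ★ p850271∕p850286 (LH5-p04): (N2) local positivity
import Literature.NumberTheory.Automorphic.ArchEndoscopicChartOrbLocalCompactPlace  -- ★ p850394 (LH5-p04): closed orbit at a compact spectator
import Literature.NumberTheory.Automorphic.ArchEndoscopicChartOrbLocalSplitPlace    -- ★ p850435 (LH5-p04): closed orbit at a split spectator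
import Literature.NumberTheory.Automorphic.ArchChartOrbHaarScaling                  -- ★ p850396 (LH3-p03): (P1) for an ARBITRARY Haar `νH` (`haarScalarFactor`)
import Literature.NumberTheory.Automorphic.UnitaryGroupArchUnimodular               -- ★ `modularCharacterFun_archLocal_eq_one` (right invariance of local Haar measures)
import Literature.MeasureTheory.Group.InvariantQuotientScaling                      -- ★ `quotientMeasure_smul_measure`
import Literature.NumberTheory.Automorphic.ArchRankOneJumpZeroCone                    -- ★ p850353 (F0P3a-p07): `cayley_conj_circleDiagonal_mem_of_eq_over` (the shared (K0±) text)
import Literature.NumberTheory.Automorphic.ArchRankOneSplitConeValuePos              -- ★ p850366 ED. 3 (F0P3b-p01): `ne_zero_of_tendsto_abs_sub_smul_integral_descConj_hypBlockGL_of_re_nonneg`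
import HarnessLib

/-!
# THE H-SIDE HEAD OF ORGAN J: for every admissible label `S`, covered wall `w₀ ∉ S` and `G`-semiregular wall point `s` there is a product test function `fH ∈ C_c^∞(H_∞)` whose
# genuine stable orbital family jumps across the wall by `(2i·C₁∕C₂) · Ψ_{insert w₀ S}(cayPt)` with a NON-ZERO Cayley value — `C₁, C₂` the SHARED rank-one constants
# (Shelstad 1979 Lemma 4.3, Thm. 4.7 (IIIb); Bouaziz 1994 §3.2 (I₃), §6.2; Rogawski 1990 §8.2 Prop. 8.2.1 (c))

Topic `NumberTheory/Rogawski1990`; namespace `Literature.NumberTheory.Rogawski1990`.  THEOREMS ONLY (no `def`, no instance, no notation, no axiom, no named fact, no `sorry`).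
Cell `pub/hodgecm-mathlib`, line LH3 (closer stub `stub_N9`, crux H413 = `stmt-HodgeConjecture-24833`), DIRECT ROAD organ J: the `hH` binder of ★ (J-JOIN-std) p850463
`jumpBricks_of_sides_std` TOKEN FOR TOKEN, over the SHARED RANK-ONE DATUM of RULINGS #8 (LH3-plan (g3) 2026-09-02T08:12:08Z; LH4-p03 (g4) cert ec6e242dc98ffe27):
`(hJ, μ₀, μ₀′, C₁, C₂, hK0 : SharedK0, hA0 : SharedA0, hlink)`; author LH10-p02 (g4).  Count-neutral.

THE PROOF (no private constants, no uniqueness: the shared `μ₀` IS used as the rank-one measure at `w₀`).  Fix `S ∌ w₀`, `s`.  (0) `σ_{w₀} Φ₂ = Φ₂ = J` (★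
`antidiagOne_map`, `StdForm.over_antidiagonal_eq`; `subst`), so `U(J)` IS `U(Φ₂)_{w₀} = archLocal L 2 Φ₂ w₀` and `μ₀` is a Haar measure there; the local reference measures are
`ν_w := haar` (right invariant: ★ `modularCharacterFun_archLocal_eq_one`), `ν_B := haar` on the compact abelian `U(Φ₁)_∞`, and `haar_{w₀} = c • μ₀`, `c = haarScalarFactor > 0`.
(1) TEST FUNCTION: ★ (N1) at the chart points `a₀ w = endoBlockAt (insert w₀ S) w (cayPt w₀ s w)`, `b₀ = (endoTorus (insert w₀ S) (cayPt w₀ s)).2`; its `w₀`-factor is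
`f₀ ∘ coe`, `f₀ = ofReal ∘ F₀ ∈ C_c(M₂(ℂ))` (★ (EXT)).  (2) READING: for the organ's ARBITRARY Haar `νH`, ★ `chartOrbH_eq_haarScalarFactor_mul_prod_chartOrbHLoc` gives the product
reading on every label with `G c = Λ · ν_B(B) · g((endoTorus · c).2)`, `Λ = haarScalarFactor νH ν_prod`.  (3) JUMP: ★ (K0H-BINDER) `hasOneSidedJump_stOrbFamH_add_smul_nrm_of_cayleyJump`
with `ν₀ := μ₀`, the shared `hK0`, and `κ := c` (★ (P4) + `integral_smul_measure`): jump `= G s · SPEC_S(s) · c · 2i · C₁ · cone(f₀, e^{i s₀})`.  (4) VALUE: ★ (V1-H)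
`stOrbFamH_insert_cayPt_eq_mul_prod_of_ray` under `hsmH fH`, the one-variable limit `ℓ₀ = c · C₂ · cone(f₀, e^{i s₀})` coming from ★ (DOCK-w₀) (torus `torusU`, any Haar `ρ`),
★ `quotientMeasure_smul_measure`, `hlink ρ` (the box of the split chart IS `B_std`) and the shared `hA0` restricted to `x → 0⁺`; spectators of `insert w₀ S` = those of `S`
(★ (T-CONGR)).  (5) ★ p850334 §3 docks jump and value with `cH · ℓ₀ = c · 2i · C₁ · cone`, i.e. **`cH = 2 · I · C₁ ∕ C₂`** (`c`, `Λ`, `cone` cancel).  (6) VALUE ≠ 0: ★ (V1-H)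
`stOrbFamH_insert_cayPt_ne_zero_of_ray` with `Λ > 0`, `ν_B(B) > 0` (compact), `g(b₀) = 1`, `ℓ₀ ≠ 0` (`c, C₂ > 0`, cone of a non-negative bump positive at the vertex `e^{i s₀}·1`),
and the spectator values ★ (N2) over the closed orbits ★ (P-cont-c∕s).
HONEST LABEL: HC_CM is proved only modulo the 7 printed citations (2 remaining: hLiu418 = `stmt-HodgeConjecture-24832`, h413 = `stmt-HodgeConjecture-24833`) until rung 0 closes;
count-neutral (this closes the H half of the (J-BRICKS) residual of organ J together with ★ (J-JOIN-std); the G′ half is LH3-p02∕LH3-p03's).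

## References
* [Shelstad1979] D. Shelstad, *Characters and inner forms of a quasi-split group over ℝ*, Compositio Math. 39 (1979), Lemma 4.3 p. 25, Prop. 4.5 p. 26, Thm. 4.7 (IIIb) p. 31.
* [Bouaziz1994IntegralesOrbitales] A. Bouaziz, *Intégrales orbitales sur les groupes de Lie réductifs*, Ann. Sci. ÉNS 27 (1994), §3.1 (I₂) p. 579, §3.2 (I₃) p. 580, §6.2 p. 591.
* [Rogawski1990] J. D. Rogawski, *Automorphic Representations of Unitary Groups in Three Variables*, Ann. of Math. Stud. 123 (1990), §8.2 Prop. 8.2.1 (c) p. 119, p. 122, §8.3 p. 124.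
* [Varadarajan1989] V. S. Varadarajan, *An Introduction to Harmonic Analysis on Semisimple Lie Groups* (1989), §6.4 Thm 23.
-/

set_option autoImplicit false

noncomputable section

open Filter Topology MeasureTheory MeasureTheory.Measure NumberField NumberField.InfinitePlace Complex Set Function Real
open Literature.NumberTheory.Automorphic Literature.NumberTheory.Automorphic.UnitaryGroup Literature.NumberTheory.Automorphic.ArchCartan
open Literature.NumberTheory.Automorphic.Shelstad1979.StableOrbitalIntegrals Literature.MeasureTheory.Group
open Literature.NumberTheory.Automorphic.UnitaryGroup.LineRing
open scoped MatrixGroups ENNReal NNReal Matrix ComplexOrder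

namespace Literature.NumberTheory.Rogawski1990

section ArchOne

variable (L : Type) [Field L] [NumberField L] [IsCMField L]

/-- **`U(Φ₁)_∞ = ∏_w U(1)` IS COMPACT** (each factor `U(σ_w Φ₁)(ℂ) = U(1)` is the unitary group of the positive-definite form `(1)`, ★ `isCompact_archLocal_of_posDef`; the
product through ★ `archPiEquivCM`). [cite: Rogawski1990, §4.9 p. 54] [cite: BorelJacquet1979, §4.1] -/
theorem compactSpace_archOne : CompactSpace ↥(arch (↥(maximalRealSubfield L)) L (IsCMField.complexConj L) 1 (Matrix.of fun i j : Fin 1 => if i.val + j.val + 1 = 1 then (1 : L) else 0)) := by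
  haveI : ∀ w : {w : InfinitePlace L // IsComplex w}, CompactSpace (↥(archLocal L 1 (Matrix.of fun i j : Fin 1 => if i.val + j.val + 1 = 1 then (1 : L) else 0) w)) := fun w => by
    have h1 : ((Matrix.of fun i j : Fin 1 => if i.val + j.val + 1 = 1 then (1 : L) else 0)).map (w.1.embedding : L →+* ℂ) = Matrix.diagonal fun _ => (1 : ℂ) := by
      ext i j; fin_cases i; fin_cases j; simp
    have hpos : (((Matrix.of fun i j : Fin 1 => if i.val + j.val + 1 = 1 then (1 : L) else 0)).map (w.1.embedding : L →+* ℂ)).PosDef := by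
      rw [h1]
      exact Matrix.PosDef.diagonal (fun _ => zero_lt_one)
    exact isCompact_iff_compactSpace.1 (isCompact_archLocal_of_posDef L 1 (Matrix.of fun i j : Fin 1 => if i.val + j.val + 1 = 1 then (1 : L) else 0) w (Or.inl hpos))
  exact (archPiEquivCM 1 L (Matrix.of fun i j : Fin 1 => if i.val + j.val + 1 = 1 then (1 : L) else 0)).toHomeomorph.symm.compactSpace

/-- **Every Haar measure on the compact group `U(Φ₁)_∞` has positive finite total mass**: `0 < ν_B.real univ` — the `hB` binder of ★ (N3). [cite: Folland1995, §2.2] -/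
theorem measureReal_univ_archOne_pos [MeasurableSpace ↥(arch (↥(maximalRealSubfield L)) L (IsCMField.complexConj L) 1 (Matrix.of fun i j : Fin 1 => if i.val + j.val + 1 = 1 then (1 : L) else 0))] [BorelSpace ↥(arch (↥(maximalRealSubfield L)) L (IsCMField.complexConj L) 1 (Matrix.of fun i j : Fin 1 => if i.val + j.val + 1 = 1 then (1 : L) else 0))] (νB : Measure ↥(arch (↥(maximalRealSubfield L)) L (IsCMField.complexConj L) 1 (Matrix.of fun i j : Fin 1 => if i.val + j.val + 1 = 1 then (1 : L) else 0))) [νB.IsHaarMeasure] : 0 < νB.real Set.univ := by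
  haveI := compactSpace_archOne L
  rw [measureReal_def]
  exact ENNReal.toReal_pos (IsOpenPosMeasure.open_pos Set.univ isOpen_univ Set.univ_nonempty) (isCompact_univ.measure_lt_top (μ := νB)).ne

end ArchOne

section HSide

open scoped Classical

variable (L : Type) [Field L] [NumberField L] [IsCMField L] (α : Fin 3 → L)
  [iH : MeasurableSpace (↥(arch (↥(maximalRealSubfield L)) L (IsCMField.complexConj L) 2 (Matrix.of fun i j : Fin 2 => if i.val + j.val + 1 = 2 then (1 : L) else 0)) ×
      ↥(arch (↥(maximalRealSubfield L)) L (IsCMField.complexConj L) 1 (Matrix.of fun i j : Fin 1 => if i.val + j.val + 1 = 1 then (1 : L) else 0)))]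
  [iHB : BorelSpace (↥(arch (↥(maximalRealSubfield L)) L (IsCMField.complexConj L) 2 (Matrix.of fun i j : Fin 2 => if i.val + j.val + 1 = 2 then (1 : L) else 0)) ×
      ↥(arch (↥(maximalRealSubfield L)) L (IsCMField.complexConj L) 1 (Matrix.of fun i j : Fin 1 => if i.val + j.val + 1 = 1 then (1 : L) else 0)))]
  (νH : Measure (↥(arch (↥(maximalRealSubfield L)) L (IsCMField.complexConj L) 2 (Matrix.of fun i j : Fin 2 => if i.val + j.val + 1 = 2 then (1 : L) else 0)) ×
      ↥(arch (↥(maximalRealSubfield L)) L (IsCMField.complexConj L) 1 (Matrix.of fun i j : Fin 1 => if i.val + j.val + 1 = 1 then (1 : L) else 0))))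
  [νH.IsHaarMeasure] [νH.IsMulRightInvariant]

set_option maxHeartbeats 400000 in
/-- **THE H-SIDE HEAD OF ORGAN J OVER THE SHARED RANK-ONE DATUM** — the `hH` binder of ★ `jumpBricks_of_sides_std`: for every admissible `S`, covered wall `w` and `G`-semiregular
wall point `s`, given smooth-boundedness of the genuine stable families (`hsmH`, from the residual's `hBZ`), there is `fH ∈ C_c^∞(H_∞)` (a product bump) with
`HasOneSidedJump (ν ↦ stOrbFamH L νH fH S (s + ν • nrm w)) ((2 * I * C₁ / C₂ : ℂ) * stOrbFamH L νH fH (insert w S) (cayPt w s))` and `stOrbFamH L νH fH (insert w S) (cayPt w s) ≠ 0`,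
where `(C₁, C₂)` are the SHARED rank-one constants of `(U(J), μ₀, μ₀′)`: `hK0` = ★ p850353's (K0±) property, `hA0` = ★ p850345's (A0) property, `hlink` = «`μ₀′` is the box-normalised
quotient of `μ₀`». [cite: Shelstad1979, Lemma 4.3 p. 25; Thm. 4.7 (IIIb) p. 31] [cite: Bouaziz1994IntegralesOrbitales, §3.2 (I₃) p. 580; §6.2 p. 591] [cite: Rogawski1990, §8.2 Prop. 8.2.1 (c) p. 119; p. 122] -/
theorem stOrbFamH_jumpSide_std
    {J : Matrix (Fin 2) (Fin 2) ℂ} (hJ : J = (StdForm.antidiagonal 2).over ℂ)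
    [iJ : MeasurableSpace ↥(unitaryGroupOfForm (starRingEnd ℂ) J)] [BorelSpace ↥(unitaryGroupOfForm (starRingEnd ℂ) J)]
    [LocallyCompactSpace ↥(unitaryGroupOfForm (starRingEnd ℂ) J)] [SecondCountableTopology ↥(unitaryGroupOfForm (starRingEnd ℂ) J)]
    (μ₀ : Measure ↥(unitaryGroupOfForm (starRingEnd ℂ) J)) [μ₀.IsHaarMeasure] [μ₀.IsMulRightInvariant]
    [iQ : MeasurableSpace (↥(unitaryGroupOfForm (starRingEnd ℂ) J) ⧸ torusU (starRingEnd ℂ) J)] [BorelSpace (↥(unitaryGroupOfForm (starRingEnd ℂ) J) ⧸ torusU (starRingEnd ℂ) J)]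
    (μ₀' : Measure (↥(unitaryGroupOfForm (starRingEnd ℂ) J) ⧸ torusU (starRingEnd ℂ) J))
    [SMulInvariantMeasure ↥(unitaryGroupOfForm (starRingEnd ℂ) J) (↥(unitaryGroupOfForm (starRingEnd ℂ) J) ⧸ torusU (starRingEnd ℂ) J) μ₀'] [IsFiniteMeasureOnCompacts μ₀']
    (C₁ C₂ : ℝ) (hC₂ : 0 < C₂)
    (hK0 : ∀ (f : Matrix (Fin 2) (Fin 2) ℂ → ℂ), Continuous f → HasCompactSupport f → ∀ z : Circle,
        HasOneSidedJump (fun ψ : ℝ => (2 * Real.sin ψ : ℂ) *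
            ∫ h : ↥(unitaryGroupOfForm (starRingEnd ℂ) J),
              f (((h * ⟨Matrix.GeneralLinearGroup.mkOfDetNeZero !![(1 : ℂ), 1; 1, -1] det_cayleyTwo_ne_zero *
                    circleDiagonal 2 ![z * Circle.exp ψ, z * Circle.exp (-ψ)] *
                    (Matrix.GeneralLinearGroup.mkOfDetNeZero !![(1 : ℂ), 1; 1, -1] det_cayleyTwo_ne_zero)⁻¹,
                  cayley_conj_circleDiagonal_mem_of_eq_over hJ _⟩ * h⁻¹ :
                ↥(unitaryGroupOfForm (starRingEnd ℂ) J)) : GL (Fin 2) ℂ) : Matrix (Fin 2) (Fin 2) ℂ) ∂μ₀)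
          ((C₁ : ℂ) * ((∫ p in Ioi (0 : ℝ) ×ˢ Ioc (0 : ℝ) (2 * π),
              f ((!![(1 : ℂ), 1; 1, -1] : Matrix (Fin 2) (Fin 2) ℂ) *
                ((z : ℂ) • (1 : Matrix (Fin 2) (Fin 2) ℂ) + p.1 • Matrix.diagonal ![(z : ℂ) * I, -((z : ℂ) * I)] +
                  p.1 • !![(0 : ℂ), -((z : ℂ) * I) * cexp (-((p.2 : ℂ) * I)); ((z : ℂ) * I) * cexp ((p.2 : ℂ) * I), 0]) *
                !![(1 / 2 : ℂ), 1 / 2; 1 / 2, -(1 / 2)])) +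
            ∫ p in Ioi (0 : ℝ) ×ˢ Ioc (0 : ℝ) (2 * π),
              f ((!![(1 : ℂ), 1; 1, -1] : Matrix (Fin 2) (Fin 2) ℂ) *
                ((z : ℂ) • (1 : Matrix (Fin 2) (Fin 2) ℂ) + p.1 • Matrix.diagonal ![-((z : ℂ) * I), (z : ℂ) * I] +
                  p.1 • !![(0 : ℂ), ((z : ℂ) * I) * cexp (-((p.2 : ℂ) * I)); -((z : ℂ) * I) * cexp ((p.2 : ℂ) * I), 0]) *
                !![(1 / 2 : ℂ), 1 / 2; 1 / 2, -(1 / 2)]))))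
    (hA0 : ∀ (f : Matrix (Fin 2) (Fin 2) ℂ → ℂ), Continuous f → HasCompactSupport f → ∀ θ : ℝ,
      Tendsto (fun x : ℝ => |Real.exp x - Real.exp (-x)| •
          ∫ y, descConj (⟨hypBlockGL x θ, hypBlockGL_mem_of_eq_over hJ x θ⟩ : ↥(unitaryGroupOfForm (starRingEnd ℂ) J)) (torusU (starRingEnd ℂ) J)
            (LineRing.forall_mem_torusU_comm (starRingEnd ℂ) J (hypBlockGL_mem_torusU hJ x θ))
            (fun g : ↥(unitaryGroupOfForm (starRingEnd ℂ) J) => f ((g : GL (Fin 2) ℂ) : Matrix (Fin 2) (Fin 2) ℂ)) y ∂μ₀')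
        (𝓝[≠] 0)
        (𝓝 (C₂ • ((∫ p in Ioi (0 : ℝ) ×ˢ Ioc (0 : ℝ) (2 * π),
            f ((!![(1 : ℂ), 1; 1, -1] : Matrix (Fin 2) (Fin 2) ℂ) *
              (Complex.exp ((θ : ℂ) * Complex.I) • (1 : Matrix (Fin 2) (Fin 2) ℂ) +
                p.1 • Matrix.diagonal ![Complex.exp ((θ : ℂ) * Complex.I) * Complex.I, -(Complex.exp ((θ : ℂ) * Complex.I) * Complex.I)] +
                p.1 • !![(0 : ℂ), -(Complex.exp ((θ : ℂ) * Complex.I) * Complex.I) * Complex.exp (-((p.2 : ℂ) * Complex.I));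
                  (Complex.exp ((θ : ℂ) * Complex.I) * Complex.I) * Complex.exp ((p.2 : ℂ) * Complex.I), 0]) *
              !![(1 / 2 : ℂ), 1 / 2; 1 / 2, -(1 / 2)])) +
          ∫ p in Ioi (0 : ℝ) ×ˢ Ioc (0 : ℝ) (2 * π),
            f ((!![(1 : ℂ), 1; 1, -1] : Matrix (Fin 2) (Fin 2) ℂ) *
              (Complex.exp ((θ : ℂ) * Complex.I) • (1 : Matrix (Fin 2) (Fin 2) ℂ) +
                p.1 • Matrix.diagonal ![-(Complex.exp ((θ : ℂ) * Complex.I) * Complex.I), Complex.exp ((θ : ℂ) * Complex.I) * Complex.I] +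
                p.1 • !![(0 : ℂ), (Complex.exp ((θ : ℂ) * Complex.I) * Complex.I) * Complex.exp (-((p.2 : ℂ) * Complex.I));
                  -(Complex.exp ((θ : ℂ) * Complex.I) * Complex.I) * Complex.exp ((p.2 : ℂ) * Complex.I), 0]) *
              !![(1 / 2 : ℂ), 1 / 2; 1 / 2, -(1 / 2)])))))
    (hμ₀' : μ₀' ≠ 0)
    (hlink : ∀ (ρ : Measure ↥(torusU (starRingEnd ℂ) J)) [ρ.IsMulLeftInvariant] [IsFiniteMeasureOnCompacts ρ] [ρ.IsOpenPosMeasure] [ρ.IsInvInvariant],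
      μ₀' = ρ ((fun p : ℝ × ℝ =>
          (⟨⟨hypBlockGL p.1 p.2, hypBlockGL_mem_of_eq_over hJ p.1 p.2⟩, hypBlockGL_mem_torusU hJ p.1 p.2⟩ : ↥(torusU (starRingEnd ℂ) J))) ''
            (Set.Icc (0 : ℝ) 1 ×ˢ Set.Icc (0 : ℝ) (2 * π))) •
        quotientMeasure (torusU (starRingEnd ℂ) J) ρ (LineRing.isClosed_torusU_two (starRingEnd ℂ) J) μ₀) :
    ∀ (S : Finset {w : InfinitePlace L // IsComplex w}) (w : {w : InfinitePlace L // IsComplex w}) (s : {w : InfinitePlace L // IsComplex w} → Fin 3 → ℝ),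
      (∀ w' ∈ S, w' ∈ splitChartPlaces L α) → IsCoveredWall (slotSign L α) S w → HcSemireg S w 0 2 s →
      (∀ fH : (↥(arch (↥(maximalRealSubfield L)) L (IsCMField.complexConj L) 2 (Matrix.of fun i j : Fin 2 => if i.val + j.val + 1 = 2 then (1 : L) else 0)) ×
        ↥(arch (↥(maximalRealSubfield L)) L (IsCMField.complexConj L) 1 (Matrix.of fun i j : Fin 1 => if i.val + j.val + 1 = 1 then (1 : L) else 0))) → ℂ,
        ArchSmooth₂ L fH → ArchBzSmoothBounded (stOrbFamH L νH fH)) →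
        ∃ fH : (↥(arch (↥(maximalRealSubfield L)) L (IsCMField.complexConj L) 2 (Matrix.of fun i j : Fin 2 => if i.val + j.val + 1 = 2 then (1 : L) else 0)) ×
        ↥(arch (↥(maximalRealSubfield L)) L (IsCMField.complexConj L) 1 (Matrix.of fun i j : Fin 1 => if i.val + j.val + 1 = 1 then (1 : L) else 0))) → ℂ,
          ArchSmooth₂ L fH ∧
            HasOneSidedJump (fun ν : ℝ => stOrbFamH L νH fH S (s + ν • nrm w)) ((2 * I * C₁ / C₂ : ℂ) * stOrbFamH L νH fH (insert w S) (cayPt w s)) ∧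
            stOrbFamH L νH fH (insert w S) (cayPt w s) ≠ 0 := by
  intro S w₀ s _hS hcov hsr hsmH
  have hw₀ : w₀ ∉ S := hcov.1
  obtain ⟨hs, hreg, hregS⟩ := hcSemireg_zero_two_hreg hsr
  haveI : Fact (0 < 2 * π) := ⟨Real.two_pi_pos⟩
  -- (0) THE FRAME: `σ_{w₀} Φ₂ = Φ₂ = J`, so `U(J)` IS `U(Φ₂)_{w₀}`; all measurable structures are Borel
  have hJ₀ : ((Matrix.of fun i j : Fin 2 => if i.val + j.val + 1 = 2 then (1 : L) else 0).map w₀.1.embedding) = (StdForm.antidiagonal 2).over ℂ := by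
    rw [Literature.NumberTheory.Rogawski1990.antidiagOne_map, StdForm.over_antidiagonal_eq]
  obtain rfl : J = ((Matrix.of fun i j : Fin 2 => if i.val + j.val + 1 = 2 then (1 : L) else 0).map w₀.1.embedding) := hJ.trans hJ₀.symm
  have hiJ : iJ = borel _ := BorelSpace.measurable_eq
  subst hiJ
  have hiQ : iQ = borel _ := BorelSpace.measurable_eq
  subst hiQ
  letI iG : MeasurableSpace ↥(unitaryGroupOfForm (starRingEnd ℂ) ((Matrix.of fun i j : Fin 2 => if i.val + j.val + 1 = 2 then (1 : L) else 0).map w₀.1.embedding)) := borel _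
  haveI : BorelSpace ↥(unitaryGroupOfForm (starRingEnd ℂ) ((Matrix.of fun i j : Fin 2 => if i.val + j.val + 1 = 2 then (1 : L) else 0).map w₀.1.embedding)) := ⟨rfl⟩
  letI iQ' : MeasurableSpace (↥(unitaryGroupOfForm (starRingEnd ℂ) ((Matrix.of fun i j : Fin 2 => if i.val + j.val + 1 = 2 then (1 : L) else 0).map w₀.1.embedding)) ⧸ torusU (starRingEnd ℂ) ((Matrix.of fun i j : Fin 2 => if i.val + j.val + 1 = 2 then (1 : L) else 0).map w₀.1.embedding)) := borel _
  haveI : BorelSpace (↥(unitaryGroupOfForm (starRingEnd ℂ) ((Matrix.of fun i j : Fin 2 => if i.val + j.val + 1 = 2 then (1 : L) else 0).map w₀.1.embedding)) ⧸ torusU (starRingEnd ℂ) ((Matrix.of fun i j : Fin 2 => if i.val + j.val + 1 = 2 then (1 : L) else 0).map w₀.1.embedding)) := ⟨rfl⟩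
  letI iW : ∀ w : {w : InfinitePlace L // IsComplex w}, MeasurableSpace (↥(archLocal L 2 (Matrix.of fun i j : Fin 2 => if i.val + j.val + 1 = 2 then (1 : L) else 0) w)) := fun w => borel _
  haveI : ∀ w : {w : InfinitePlace L // IsComplex w}, BorelSpace (↥(archLocal L 2 (Matrix.of fun i j : Fin 2 => if i.val + j.val + 1 = 2 then (1 : L) else 0) w)) := fun w => ⟨rfl⟩
  haveI : ∀ w : {w : InfinitePlace L // IsComplex w}, LocallyCompactSpace (↥(archLocal L 2 (Matrix.of fun i j : Fin 2 => if i.val + j.val + 1 = 2 then (1 : L) else 0) w)) := fun w => locallyCompactSpace_archLocal_two L w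
  haveI : ∀ w : {w : InfinitePlace L // IsComplex w}, SecondCountableTopology (↥(archLocal L 2 (Matrix.of fun i j : Fin 2 => if i.val + j.val + 1 = 2 then (1 : L) else 0) w)) := fun w => secondCountableTopology_archLocal_two L w
  -- the factor structures on `U(Φ₂)_∞` and `U(Φ₁)_∞` are Borel, and the organ's structure on the product IS their product
  letI iH2 : MeasurableSpace ↥(arch (↥(maximalRealSubfield L)) L (IsCMField.complexConj L) 2 (Matrix.of fun i j : Fin 2 => if i.val + j.val + 1 = 2 then (1 : L) else 0)) := borel _
  haveI : BorelSpace ↥(arch (↥(maximalRealSubfield L)) L (IsCMField.complexConj L) 2 (Matrix.of fun i j : Fin 2 => if i.val + j.val + 1 = 2 then (1 : L) else 0)) := ⟨rfl⟩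
  letI iB : MeasurableSpace ↥(arch (↥(maximalRealSubfield L)) L (IsCMField.complexConj L) 1 (Matrix.of fun i j : Fin 1 => if i.val + j.val + 1 = 1 then (1 : L) else 0)) := borel _
  haveI : BorelSpace ↥(arch (↥(maximalRealSubfield L)) L (IsCMField.complexConj L) 1 (Matrix.of fun i j : Fin 1 => if i.val + j.val + 1 = 1 then (1 : L) else 0)) := ⟨rfl⟩
  have hiH : iH = @Prod.instMeasurableSpace ↥(arch (↥(maximalRealSubfield L)) L (IsCMField.complexConj L) 2 (Matrix.of fun i j : Fin 2 => if i.val + j.val + 1 = 2 then (1 : L) else 0)) ↥(arch (↥(maximalRealSubfield L)) L (IsCMField.complexConj L) 1 (Matrix.of fun i j : Fin 1 => if i.val + j.val + 1 = 1 then (1 : L) else 0)) (borel _) (borel _) :=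
    (@BorelSpace.measurable_eq _ _ iH iHB).trans
      (@BorelSpace.measurable_eq _ _ (@Prod.instMeasurableSpace ↥(arch (↥(maximalRealSubfield L)) L (IsCMField.complexConj L) 2 (Matrix.of fun i j : Fin 2 => if i.val + j.val + 1 = 2 then (1 : L) else 0)) ↥(arch (↥(maximalRealSubfield L)) L (IsCMField.complexConj L) 1 (Matrix.of fun i j : Fin 1 => if i.val + j.val + 1 = 1 then (1 : L) else 0)) (borel _) (borel _)) Prod.borelSpace).symm
  subst hiH
  haveI := compactSpace_archOne L
  -- the form is `c`-hermitian and non-degenerate: local Haar measures are right invariant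
  have hherm : (((Matrix.of fun i j : Fin 2 => if i.val + j.val + 1 = 2 then (1 : L) else 0)).map (cmConjRingHom L))ᵀ = (Matrix.of fun i j : Fin 2 => if i.val + j.val + 1 = 2 then (1 : L) else 0) := by
    rw [← StdForm.over_antidiagonal_eq]; exact cmConj_antidiagonal_transpose L 2
  have hdet : ((Matrix.of fun i j : Fin 2 => if i.val + j.val + 1 = 2 then (1 : L) else 0)).det ≠ 0 := by
    rw [Matrix.det_fin_two]; simp
  -- reference measures: `haar` at every place and on `U(Φ₁)_∞`
  let νw : ∀ w : {w : InfinitePlace L // IsComplex w}, Measure (↥(archLocal L 2 (Matrix.of fun i j : Fin 2 => if i.val + j.val + 1 = 2 then (1 : L) else 0) w)) := fun w => Measure.haar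
  haveI hνwH : ∀ w, (νw w).IsHaarMeasure := fun w => by simp only [νw]; infer_instance
  haveI : ∀ w, (νw w).IsMulRightInvariant := fun w =>
    isMulRightInvariant_of_modularCharacterFun_eq_one
      (modularCharacterFun_archLocal_eq_one L (Matrix.of fun i j : Fin 2 => if i.val + j.val + 1 = 2 then (1 : L) else 0) hherm hdet w) (νw w)
  let νB : Measure ↥(arch (↥(maximalRealSubfield L)) L (IsCMField.complexConj L) 1 (Matrix.of fun i j : Fin 1 => if i.val + j.val + 1 = 1 then (1 : L) else 0)) := Measure.haar
  haveI : νB.IsMulRightInvariant := by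
    letI : CommGroup ↥(arch (↥(maximalRealSubfield L)) L (IsCMField.complexConj L) 1 (Matrix.of fun i j : Fin 1 => if i.val + j.val + 1 = 1 then (1 : L) else 0)) := { (inferInstance : Group ↥(arch (↥(maximalRealSubfield L)) L (IsCMField.complexConj L) 1 (Matrix.of fun i j : Fin 1 => if i.val + j.val + 1 = 1 then (1 : L) else 0))) with mul_comm := archOne_mul_comm L }
    infer_instance
  have hB : 0 < νB.real Set.univ := measureReal_univ_archOne_pos L νB
  haveI := isHaarMeasure_prodConventionH L νw νB
  set Λ : ℝ≥0 := haarScalarFactor νH (((Measure.pi νw).map (archPiEquivCM 2 L (Matrix.of fun i j : Fin 2 => if i.val + j.val + 1 = 2 then (1 : L) else 0)).symm).prod νB) with hΛdef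
  have hΛ : 0 < Λ := haarScalarFactor_pos_of_isHaarMeasure _ _
  -- the shared `μ₀` as the rank-one measure AT `w₀`: `haar_{w₀} = c • μ₀`
  let μ₀A : Measure (↥(archLocal L 2 (Matrix.of fun i j : Fin 2 => if i.val + j.val + 1 = 2 then (1 : L) else 0) w₀)) := μ₀
  haveI : μ₀A.IsHaarMeasure := ‹μ₀.IsHaarMeasure›
  set c : ℝ≥0 := haarScalarFactor (νw w₀) μ₀A with hcdef
  have hc : c ≠ 0 := (haarScalarFactor_pos_of_isHaarMeasure (νw w₀) μ₀A).ne'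
  have hνc : νw w₀ = c • μ₀A := isMulLeftInvariant_eq_smul (νw w₀) μ₀A
  -- (1) THE TEST FUNCTION: ★ (N1) at the chart points, `w₀`-factor extended to `M₂(ℂ)` by ★ (EXT)
  set a₀ : ∀ w : {w : InfinitePlace L // IsComplex w}, ↥(archLocal L 2 (Matrix.of fun i j : Fin 2 => if i.val + j.val + 1 = 2 then (1 : L) else 0) w) := fun w => endoBlockAt L (insert w₀ S) w (cayPt w₀ s w) with ha₀
  set b₀ : ↥(arch (↥(maximalRealSubfield L)) L (IsCMField.complexConj L) 1 (Matrix.of fun i j : Fin 1 => if i.val + j.val + 1 = 1 then (1 : L) else 0)) := (endoTorus L (insert w₀ S) (cayPt w₀ s)).2 with hb₀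
  obtain ⟨f, g, hf, hg, hsm⟩ := exists_archSmooth₂_prod L a₀ b₀
  set fH : ↥(arch (↥(maximalRealSubfield L)) L (IsCMField.complexConj L) 2 (Matrix.of fun i j : Fin 2 => if i.val + j.val + 1 = 2 then (1 : L) else 0)) × ↥(arch (↥(maximalRealSubfield L)) L (IsCMField.complexConj L) 1 (Matrix.of fun i j : Fin 1 => if i.val + j.val + 1 = 1 then (1 : L) else 0)) → ℂ :=
    fun k => (∏ w, ((f w (archPiEquivCM 2 L (Matrix.of fun i j : Fin 2 => if i.val + j.val + 1 = 2 then (1 : L) else 0) k.1 w) : ℝ) : ℂ)) * ((g k.2 : ℝ) : ℂ) with hfHdef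
  have hfH : ∀ a b, fH (a, b) = (∏ w, (fun w x => ((f w x : ℝ) : ℂ)) w (archPiEquivCM 2 L (Matrix.of fun i j : Fin 2 => if i.val + j.val + 1 = 2 then (1 : L) else 0) a w)) * (fun b => ((g b : ℝ) : ℂ)) b :=
    fun a b => rfl
  have hdet₀ : (((Matrix.of fun i j : Fin 2 => if i.val + j.val + 1 = 2 then (1 : L) else 0).map w₀.1.embedding)).det ≠ 0 := by
    rw [hJ, StdForm.over_antidiagonal_eq, Matrix.det_fin_two]; simp
  obtain ⟨F₀, hF₀c, hF₀s, hF₀eq⟩ := exists_hasCompactSupport_extend (((Matrix.of fun i j : Fin 2 => if i.val + j.val + 1 = 2 then (1 : L) else 0).map w₀.1.embedding)) hdet₀ (f w₀) (hf w₀).1 (hf w₀).2.1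
  set f₀ : Matrix (Fin 2) (Fin 2) ℂ → ℂ := fun X => ((F₀ X : ℝ) : ℂ) with hf₀def
  have hf₀ : Continuous f₀ := Complex.continuous_ofReal.comp hF₀c
  have hf₀c : HasCompactSupport f₀ := hF₀s.comp_left (g := fun r : ℝ => (r : ℂ)) Complex.ofReal_zero
  have hfw₀ : ∀ x : ↥(archLocal L 2 (Matrix.of fun i j : Fin 2 => if i.val + j.val + 1 = 2 then (1 : L) else 0) w₀), (fun w (x : ↥(archLocal L 2 (Matrix.of fun i j : Fin 2 => if i.val + j.val + 1 = 2 then (1 : L) else 0) w)) => ((f w x : ℝ) : ℂ)) w₀ x = f₀ ((x : GL (Fin 2) ℂ) : Matrix (Fin 2) (Fin 2) ℂ) :=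
    fun x => by simp only [hf₀def, hF₀eq]
  -- (2) THE PRODUCT READINGS for the organ's `νH` (★ Haar scaling ∘ (P1)); the prefactor reads slot `1` only
  have hP : ∀ (T : Finset {w : InfinitePlace L // IsComplex w}) (c' : {w : InfinitePlace L // IsComplex w} → Fin 3 → ℝ), chartOrbH L νH T fH c' =
      (fun c' => ((Λ : ℝ) : ℂ) * ((νB.real Set.univ : ℂ) * ((g (endoTorus L T c').2 : ℝ) : ℂ))) c' *
        ∏ w, (fun w v => chartOrbHLoc L T w (νw w) (fun x => ((f w x : ℝ) : ℂ)) v) w (c' w) := fun T c' => by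
    rw [chartOrbH_eq_haarScalarFactor_mul_prod_chartOrbHLoc L νw νB T νH fH (fun w x => ((f w x : ℝ) : ℂ)) (fun b => ((g b : ℝ) : ℂ)) hfH c']
    ring
  have hGsnd : ∀ (T T' : Finset {w : InfinitePlace L // IsComplex w}) (c' c'' : {w : InfinitePlace L // IsComplex w} → Fin 3 → ℝ), (∀ w, c' w 1 = c'' w 1) →
      ((Λ : ℝ) : ℂ) * ((νB.real Set.univ : ℂ) * ((g (endoTorus L T c').2 : ℝ) : ℂ)) = ((Λ : ℝ) : ℂ) * ((νB.real Set.univ : ℂ) * ((g (endoTorus L T' c'').2 : ℝ) : ℂ)) :=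
    fun T T' c' c'' h => by rw [endoTorus_snd_eq_of_forall_apply_one L T T' h]
  -- (3) THE JUMP with the shared `C₁`: ★ (K0H-BINDER) at `ν₀ := μ₀`, `κ := c`
  have hmeas : Measurable (fun x : ↥(archLocal L 2 (Matrix.of fun i j : Fin 2 => if i.val + j.val + 1 = 2 then (1 : L) else 0) w₀) => ((f w₀ x : ℝ) : ℂ)) := (Complex.continuous_ofReal.comp (hf w₀).1).measurable
  have hE : ∀ v : Fin 3 → ℝ, endoBlockAt L S w₀ v =
      ⟨Matrix.GeneralLinearGroup.mkOfDetNeZero !![(1 : ℂ), 1; 1, -1] det_cayleyTwo_ne_zero * circleDiagonal 2 ![Circle.exp (v 0), Circle.exp (v 2)] *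
          (Matrix.GeneralLinearGroup.mkOfDetNeZero !![(1 : ℂ), 1; 1, -1] det_cayleyTwo_ne_zero)⁻¹,
        cayley_conj_circleDiagonal_mem_archLocal L w₀ _⟩ :=
    fun v => Subtype.ext (coe_endoBlock_eq_cayley_of_not_mem L S (fun _ => v) hw₀)
  have hQ : ∀ v : Fin 3 → ℝ, (fun w v => chartOrbHLoc L S w (νw w) (fun x => ((f w x : ℝ) : ℂ)) v) w₀ v = (c : ℂ) *
      ∫ h : ↥(archLocal L 2 (Matrix.of fun i j : Fin 2 => if i.val + j.val + 1 = 2 then (1 : L) else 0) w₀),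
        f₀ (((h * ⟨Matrix.GeneralLinearGroup.mkOfDetNeZero !![(1 : ℂ), 1; 1, -1] det_cayleyTwo_ne_zero *
              circleDiagonal 2 ![Circle.exp (v 0), Circle.exp (v 2)] *
              (Matrix.GeneralLinearGroup.mkOfDetNeZero !![(1 : ℂ), 1; 1, -1] det_cayleyTwo_ne_zero)⁻¹,
            cayley_conj_circleDiagonal_mem_archLocal L w₀ _⟩ * h⁻¹ : ↥(archLocal L 2 (Matrix.of fun i j : Fin 2 => if i.val + j.val + 1 = 2 then (1 : L) else 0) w₀)) : GL (Fin 2) ℂ) : Matrix (Fin 2) (Fin 2) ℂ) ∂μ₀A := by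
    intro v
    simp only []
    rw [chartOrbHLoc_eq_integral_of_not_mem L S w₀ (νw w₀) hw₀ _ hmeas v, hE v, hνc, integral_smul_nnreal_measure]
    simp_rw [hfw₀]
    rw [NNReal.smul_def, Complex.real_smul]
  have hJmp := hasOneSidedJump_stOrbFamH_add_smul_nrm_of_cayleyJump L νH w₀ μ₀A C₁ hK0 fH S hw₀ s hs hreg hregS
    (fun c' => ((Λ : ℝ) : ℂ) * ((νB.real Set.univ : ℂ) * ((g (endoTorus L S c').2 : ℝ) : ℂ)))
    (fun w v => chartOrbHLoc L S w (νw w) (fun x => ((f w x : ℝ) : ℂ)) v)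
    (fun c' _ => hP S c') (fun c' c'' h => hGsnd S S c' c'' h) (c : ℂ) f₀ hf₀ hf₀c hQ
  -- (4) THE CAYLEY VALUE with the shared `C₂` along the ray (★ (V1-H)), through ★ (DOCK-w₀) + `hlink` + ★ `quotientMeasure_smul_measure`
  have hΨ : ArchBzSmoothBounded (stOrbFamH L νH fH) := hsmH fH hsm
  have hw1 : w₀ ∈ insert w₀ S := Finset.mem_insert_self w₀ S
  haveI : LocallyCompactSpace ↥(unitaryGroupOfForm (starRingEnd ℂ) ((Matrix.of fun i j : Fin 2 => if i.val + j.val + 1 = 2 then (1 : L) else 0).map w₀.1.embedding)) := locallyCompactSpace_unitaryGroupOfForm_complex _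
  haveI : SecondCountableTopology ↥(unitaryGroupOfForm (starRingEnd ℂ) ((Matrix.of fun i j : Fin 2 => if i.val + j.val + 1 = 2 then (1 : L) else 0).map w₀.1.embedding)) := secondCountableTopology_unitaryGroupOfForm_complex _
  have hTc : IsClosed (((torusU (starRingEnd ℂ) ((Matrix.of fun i j : Fin 2 => if i.val + j.val + 1 = 2 then (1 : L) else 0).map w₀.1.embedding)) : Subgroup ↥(unitaryGroupOfForm (starRingEnd ℂ) ((Matrix.of fun i j : Fin 2 => if i.val + j.val + 1 = 2 then (1 : L) else 0).map w₀.1.embedding))) : Set ↥(unitaryGroupOfForm (starRingEnd ℂ) ((Matrix.of fun i j : Fin 2 => if i.val + j.val + 1 = 2 then (1 : L) else 0).map w₀.1.embedding))) := isClosed_torusU_two _ _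
  haveI : LocallyCompactSpace ↥(torusU (starRingEnd ℂ) ((Matrix.of fun i j : Fin 2 => if i.val + j.val + 1 = 2 then (1 : L) else 0).map w₀.1.embedding)) := hTc.isClosedEmbedding_subtypeVal.locallyCompactSpace
  haveI : SecondCountableTopology ↥(torusU (starRingEnd ℂ) ((Matrix.of fun i j : Fin 2 => if i.val + j.val + 1 = 2 then (1 : L) else 0).map w₀.1.embedding)) := TopologicalSpace.Subtype.secondCountableTopology _
  haveI : BorelSpace ↥(torusU (starRingEnd ℂ) ((Matrix.of fun i j : Fin 2 => if i.val + j.val + 1 = 2 then (1 : L) else 0).map w₀.1.embedding)) := Subtype.borelSpace _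
  set ρ : Measure ↥(torusU (starRingEnd ℂ) ((Matrix.of fun i j : Fin 2 => if i.val + j.val + 1 = 2 then (1 : L) else 0).map w₀.1.embedding)) := Measure.haar with hρ
  haveI : ρ.IsInvInvariant :=
    Literature.MeasureTheory.Group.isInvInvariant_of_comm _ hTc (fun x hx y hy => LineRing.forall_mem_torusU_comm (starRingEnd ℂ) _ hy x hx) ρ
  let TAL : Subgroup ↥(archLocal L 2 (Matrix.of fun i j : Fin 2 => if i.val + j.val + 1 = 2 then (1 : L) else 0) w₀) := torusU (starRingEnd ℂ) ((Matrix.of fun i j : Fin 2 => if i.val + j.val + 1 = 2 then (1 : L) else 0).map w₀.1.embedding)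
  let ρAL : Measure ↥TAL := ρ
  haveI : ρAL.IsHaarMeasure := (inferInstance : ρ.IsHaarMeasure)
  haveI : ρAL.IsInvInvariant := ‹ρ.IsInvInvariant›
  letI iQA : MeasurableSpace (↥(archLocal L 2 (Matrix.of fun i j : Fin 2 => if i.val + j.val + 1 = 2 then (1 : L) else 0) w₀) ⧸ TAL) := borel _
  haveI : BorelSpace (↥(archLocal L 2 (Matrix.of fun i j : Fin 2 => if i.val + j.val + 1 = 2 then (1 : L) else 0) w₀) ⧸ TAL) := ⟨rfl⟩
  -- the box of the split chart `insert w₀ S` at `w₀`, read in `torusU`, IS `B_std`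
  have hbox : {m : ↥TAL | (m : ↥(archLocal L 2 (Matrix.of fun i j : Fin 2 => if i.val + j.val + 1 = 2 then (1 : L) else 0) w₀)) ∈ ((↑) : ↥(chartTorusHLoc L (insert w₀ S) w₀) → ↥(archLocal L 2 (Matrix.of fun i j : Fin 2 => if i.val + j.val + 1 = 2 then (1 : L) else 0) w₀)) '' chartBoxImgLoc L (insert w₀ S) w₀} =
      (fun p : ℝ × ℝ => (⟨⟨hypBlockGL p.1 p.2, hypBlockGL_mem_of_eq_over hJ p.1 p.2⟩, hypBlockGL_mem_torusU hJ p.1 p.2⟩ : ↥(torusU (starRingEnd ℂ) ((Matrix.of fun i j : Fin 2 => if i.val + j.val + 1 = 2 then (1 : L) else 0).map w₀.1.embedding)))) ''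
        (Set.Icc (0 : ℝ) 1 ×ˢ Set.Icc (0 : ℝ) (2 * π)) := by
    ext m
    constructor
    · rintro ⟨t, ⟨cw, hcw, rfl⟩, hmt⟩
      have h0 : cw 0 ∈ Set.Icc (0 : ℝ) 1 := by
        simpa [hw1] using hcw 0 (Set.mem_univ _)
      have h2 : cw 2 ∈ Set.Icc (0 : ℝ) (2 * π) := by
        simpa using hcw 2 (Set.mem_univ _)
      refine ⟨(cw 0, cw 2), ⟨h0, h2⟩, Subtype.ext ?_⟩
      rw [← hmt]
      exact (endoBlockAt_eq_mk_hypBlockGL L (insert w₀ S) hw1 cw).symm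
    · rintro ⟨p, ⟨hx, hθ⟩, rfl⟩
      refine ⟨⟨endoBlockAt L (insert w₀ S) w₀ ![p.1, 0, p.2], endoBlockAt_mem_chartTorusHLoc L (insert w₀ S) w₀ _⟩, ⟨![p.1, 0, p.2], ?_, rfl⟩, ?_⟩
      · intro i _
        fin_cases i
        · simpa [hw1] using hx
        · refine ⟨le_rfl, ?_⟩
          split_ifs
          · exact zero_le_one
          · positivity
        · simpa using hθ
      · exact endoBlockAt_eq_mk_hypBlockGL L (insert w₀ S) hw1 ![p.1, 0, p.2]
  -- the `w₀`-functional of the split chart read through `torusU` against `μ₀′`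
  have hc0 : ((c : ℝ≥0∞)) ≠ 0 := by exact_mod_cast hc
  haveI : μ₀A.IsMulRightInvariant := ‹μ₀.IsMulRightInvariant›
  haveI : IsFiniteMeasureOnCompacts (((c : ℝ≥0∞)) • μ₀A) := IsFiniteMeasureOnCompacts.smul μ₀A ENNReal.coe_ne_top
  have hνc' : νw w₀ = ((c : ℝ≥0∞)) • μ₀A := by
    rw [hνc]; ext s' hs'; simp only [Measure.smul_apply, ENNReal.smul_def, smul_eq_mul]
  have hTcA : IsClosed ((TAL : Subgroup ↥(archLocal L 2 (Matrix.of fun i j : Fin 2 => if i.val + j.val + 1 = 2 then (1 : L) else 0) w₀)) : Set ↥(archLocal L 2 (Matrix.of fun i j : Fin 2 => if i.val + j.val + 1 = 2 then (1 : L) else 0) w₀)) := hTc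
  have hQm : quotientMeasure TAL ρAL hTcA (νw w₀) = quotientMeasure TAL ρAL hTcA (((c : ℝ≥0∞)) • μ₀A) := by
    have key : ∀ (ν₁ ν₂ : Measure ↥(archLocal L 2 (Matrix.of fun i j : Fin 2 => if i.val + j.val + 1 = 2 then (1 : L) else 0) w₀)) [IsFiniteMeasureOnCompacts ν₁] [ν₁.IsMulRightInvariant] [IsFiniteMeasureOnCompacts ν₂] [ν₂.IsMulRightInvariant],
        ν₁ = ν₂ → quotientMeasure TAL ρAL hTcA ν₁ = quotientMeasure TAL ρAL hTcA ν₂ := by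
      intro ν₁ ν₂ _ _ _ _ h; subst h; rfl
    exact key _ _ hνc'
  have hdock : ∀ v : Fin 3 → ℝ, (fun w v => chartOrbHLoc L (insert w₀ S) w (νw w) (fun x => ((f w x : ℝ) : ℂ)) v) w₀ v = (c : ℂ) *
      ∫ y, descConj (⟨hypBlockGL (v 0) (v 2), hypBlockGL_mem_of_eq_over hJ (v 0) (v 2)⟩ : ↥(unitaryGroupOfForm (starRingEnd ℂ) ((Matrix.of fun i j : Fin 2 => if i.val + j.val + 1 = 2 then (1 : L) else 0).map w₀.1.embedding))) (torusU (starRingEnd ℂ) ((Matrix.of fun i j : Fin 2 => if i.val + j.val + 1 = 2 then (1 : L) else 0).map w₀.1.embedding))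
            (LineRing.forall_mem_torusU_comm (starRingEnd ℂ) _ (hypBlockGL_mem_torusU hJ (v 0) (v 2)))
            (fun g : ↥(unitaryGroupOfForm (starRingEnd ℂ) ((Matrix.of fun i j : Fin 2 => if i.val + j.val + 1 = 2 then (1 : L) else 0).map w₀.1.embedding)) => f₀ ((g : GL (Fin 2) ℂ) : Matrix (Fin 2) (Fin 2) ℂ)) y ∂μ₀' := by
    intro v
    simp only []
    rw [chartOrbHLoc_eq_of_chartTorusHLoc_eq L (insert w₀ S) w₀ (νw w₀) (T := TAL) (chartTorusHLoc_eq_torusU L (insert w₀ S) hw1) hTcA (iT := iQA) ρAL _ v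
      (LineRing.forall_mem_torusU_comm (starRingEnd ℂ) _ ((chartTorusHLoc_eq_torusU L (insert w₀ S) hw1) ▸ endoBlockAt_mem_chartTorusHLoc L (insert w₀ S) w₀ v))]
    have hfun : descConj (endoBlockAt L (insert w₀ S) w₀ v) TAL
          (LineRing.forall_mem_torusU_comm (starRingEnd ℂ) _ ((chartTorusHLoc_eq_torusU L (insert w₀ S) hw1) ▸ endoBlockAt_mem_chartTorusHLoc L (insert w₀ S) w₀ v))
          (fun x : ↥(archLocal L 2 (Matrix.of fun i j : Fin 2 => if i.val + j.val + 1 = 2 then (1 : L) else 0) w₀) => ((f w₀ x : ℝ) : ℂ)) =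
        descConj (⟨hypBlockGL (v 0) (v 2), hypBlockGL_mem_archLocal L w₀ (v 0) (v 2)⟩ : ↥(archLocal L 2 (Matrix.of fun i j : Fin 2 => if i.val + j.val + 1 = 2 then (1 : L) else 0) w₀)) TAL
          (fun m hm => LineRing.forall_mem_torusU_comm (starRingEnd ℂ) _ (hypBlockGL_mem_torusU hJ (v 0) (v 2)) m hm)
          (fun g : ↥(archLocal L 2 (Matrix.of fun i j : Fin 2 => if i.val + j.val + 1 = 2 then (1 : L) else 0) w₀) => f₀ ((g : GL (Fin 2) ℂ) : Matrix (Fin 2) (Fin 2) ℂ)) := by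
      funext y
      induction y using QuotientGroup.induction_on with
      | H g => rw [descConj_mk, descConj_mk, endoBlockAt_eq_mk_hypBlockGL L (insert w₀ S) hw1 v]; exact hfw₀ _
    rw [hfun, hbox, hQm, quotientMeasure_smul_measure TAL hTcA ρAL μ₀A hc0 ENNReal.coe_ne_top, integral_smul_measure, ENNReal.coe_toReal, hlink ρ,
      integral_smul_measure]
    simp only [Complex.real_smul]
    rw [mul_left_comm]
    rfl
  -- the one-variable (A0) limit along the ray, in the ★ (K0±) tokens: `ℓ₀ = c · C₂ · cone(f₀, e^{i s₀})`
  have hA0' := (hA0 f₀ hf₀ hf₀c (s w₀ 0)).mono_left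
    (nhdsWithin_mono (0 : ℝ) (fun x (hx : x ∈ Ioi (0 : ℝ)) => Set.mem_compl_singleton_iff.2 (ne_of_gt hx)))
  have hA0ray : Tendsto (fun x : ℝ => (((|Real.exp x - Real.exp (-x)| : ℝ) : ℂ) * (fun w v => chartOrbHLoc L (insert w₀ S) w (νw w) (fun x => ((f w x : ℝ) : ℂ)) v) w₀ ![x, s w₀ 1, s w₀ 0])) (𝓝[>] 0)
      (𝓝 ((c : ℂ) * ((C₂ : ℂ) * ((∫ p in Ioi (0 : ℝ) ×ˢ Ioc (0 : ℝ) (2 * π),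
                f₀ ((!![(1 : ℂ), 1; 1, -1] : Matrix (Fin 2) (Fin 2) ℂ) *
                  (((Circle.exp (s w₀ 0) : Circle) : ℂ) • (1 : Matrix (Fin 2) (Fin 2) ℂ) +
                    p.1 • Matrix.diagonal ![((Circle.exp (s w₀ 0) : Circle) : ℂ) * I, -(((Circle.exp (s w₀ 0) : Circle) : ℂ) * I)] +
                    p.1 • !![(0 : ℂ), -(((Circle.exp (s w₀ 0) : Circle) : ℂ) * I) * cexp (-((p.2 : ℂ) * I));
                      (((Circle.exp (s w₀ 0) : Circle) : ℂ) * I) * cexp ((p.2 : ℂ) * I), 0]) *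
                  !![(1 / 2 : ℂ), 1 / 2; 1 / 2, -(1 / 2)])) +
              ∫ p in Ioi (0 : ℝ) ×ˢ Ioc (0 : ℝ) (2 * π),
                f₀ ((!![(1 : ℂ), 1; 1, -1] : Matrix (Fin 2) (Fin 2) ℂ) *
                  (((Circle.exp (s w₀ 0) : Circle) : ℂ) • (1 : Matrix (Fin 2) (Fin 2) ℂ) +
                    p.1 • Matrix.diagonal ![-(((Circle.exp (s w₀ 0) : Circle) : ℂ) * I), ((Circle.exp (s w₀ 0) : Circle) : ℂ) * I] +
                    p.1 • !![(0 : ℂ), (((Circle.exp (s w₀ 0) : Circle) : ℂ) * I) * cexp (-((p.2 : ℂ) * I));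
                      -(((Circle.exp (s w₀ 0) : Circle) : ℂ) * I) * cexp ((p.2 : ℂ) * I), 0]) *
                  !![(1 / 2 : ℂ), 1 / 2; 1 / 2, -(1 / 2)]))))) := by
    have h1 := hA0'.const_mul (c : ℂ)
    rw [Complex.real_smul] at h1
    simp only [← Circle.coe_exp] at h1
    refine h1.congr fun x => ?_
    rw [hdock]
    simp only [Matrix.cons_val_zero, Matrix.cons_val_two, Matrix.tail_cons, Matrix.head_cons, Complex.real_smul]
    ring
  -- the prefactor is flip-invariant and CONSTANT along the ray
  have hG' : ∀ T : Finset {w : InfinitePlace L // IsComplex w}, (∀ w ∈ T, w ∉ insert w₀ S) → ∀ c' : {w : InfinitePlace L // IsComplex w} → Fin 3 → ℝ, (fun c' => ((Λ : ℝ) : ℂ) * ((νB.real Set.univ : ℂ) * ((g (endoTorus L (insert w₀ S) c').2 : ℝ) : ℂ))) (flipSet T c') = (fun c' => ((Λ : ℝ) : ℂ) * ((νB.real Set.univ : ℂ) * ((g (endoTorus L (insert w₀ S) c').2 : ℝ) : ℂ))) c' :=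
    fun T _ c' => hGsnd (insert w₀ S) (insert w₀ S) _ _ fun w => by rw [flipSet_apply]; split_ifs <;> simp
  have hGray : ∀ x : ℝ, (fun c' => ((Λ : ℝ) : ℂ) * ((νB.real Set.univ : ℂ) * ((g (endoTorus L (insert w₀ S) c').2 : ℝ) : ℂ))) (Function.update s w₀ ![x, s w₀ 1, s w₀ 0]) = (fun c' => ((Λ : ℝ) : ℂ) * ((νB.real Set.univ : ℂ) * ((g (endoTorus L S c').2 : ℝ) : ℂ))) s := fun x =>
    hGsnd (insert w₀ S) S _ _ fun w => by
      by_cases hw : w = w₀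
      · subst hw; rw [update_ray_apply_self]; simp only [Matrix.cons_val_one, Matrix.cons_val_zero]
      · rw [update_ray_apply_of_ne s hw]
  have hGt' : Tendsto (fun x : ℝ => (fun c' => ((Λ : ℝ) : ℂ) * ((νB.real Set.univ : ℂ) * ((g (endoTorus L (insert w₀ S) c').2 : ℝ) : ℂ))) (Function.update s w₀ ![x, s w₀ 1, s w₀ 0])) (𝓝[>] 0) (𝓝 ((fun c' => ((Λ : ℝ) : ℂ) * ((νB.real Set.univ : ℂ) * ((g (endoTorus L S c').2 : ℝ) : ℂ))) s)) := by
    simp only [hGray]; exact tendsto_const_nhds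
  have hV := stOrbFamH_insert_cayPt_eq_mul_prod_of_ray L νH fH hΨ S hw₀ hs hreg hregS (G := (fun c' => ((Λ : ℝ) : ℂ) * ((νB.real Set.univ : ℂ) * ((g (endoTorus L (insert w₀ S) c').2 : ℝ) : ℂ)))) (φ := (fun w v => chartOrbHLoc L (insert w₀ S) w (νw w) (fun x => ((f w x : ℝ) : ℂ)) v))
    (fun c' _ => hP (insert w₀ S) c') hG' hGt' hA0ray
  -- spectators of `insert w₀ S` ARE those of `S` off `w₀`
  have hφ : ∀ w, w ≠ w₀ → (fun w v => chartOrbHLoc L (insert w₀ S) w (νw w) (fun x => ((f w x : ℝ) : ℂ)) v) w = (fun w v => chartOrbHLoc L S w (νw w) (fun x => ((f w x : ℝ) : ℂ)) v) w := fun w hne =>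
    funext fun v => chartOrbHLoc_insert_of_ne L w (νw w) hne S _ v
  refine ⟨fH, hsm, ?_, ?_⟩
  · -- (5) DOCK jump and value: `cH · ℓ₀ = c · 2i · C₁ · cone` with `cH = 2 I C₁ ∕ C₂`
    refine hasOneSidedJump_cayPt_of_jump_of_value L νH fH S w₀ s (G := (fun c' => ((Λ : ℝ) : ℂ) * ((νB.real Set.univ : ℂ) * ((g (endoTorus L S c').2 : ℝ) : ℂ)))) (φ := (fun w v => chartOrbHLoc L S w (νw w) (fun x => ((f w x : ℝ) : ℂ)) v)) (φ' := (fun w v => chartOrbHLoc L (insert w₀ S) w (νw w) (fun x => ((f w x : ℝ) : ℂ)) v)) hJmp hV rfl hφ ?_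
    have hC₂' : (C₂ : ℂ) ≠ 0 := by exact_mod_cast hC₂.ne'
    have key : ∀ K : ℂ, (2 * I * C₁ / C₂ : ℂ) * ((c : ℂ) * ((C₂ : ℂ) * K)) = (c : ℂ) * (2 * I * ((C₁ : ℂ) * K)) := fun K => by
      field_simp
    exact key _
  · -- (6) NON-VANISHING of the Cayley value
    have hb₀' : (endoTorus L S s).2 = b₀ := endoTorus_snd_eq_of_forall_apply_one L S (insert w₀ S) fun w => (cayPt_apply_one w₀ s w).symm
    have hg₀ : (fun c' => ((Λ : ℝ) : ℂ) * ((νB.real Set.univ : ℂ) * ((g (endoTorus L S c').2 : ℝ) : ℂ))) s ≠ 0 := by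
      simp only [hb₀', hg.2.2.2]
      refine mul_ne_zero (by exact_mod_cast hΛ.ne') (mul_ne_zero (by exact_mod_cast hB.ne') (by norm_num))
    -- `ℓ₀ ≠ 0`: ANY stated value of the (A0) limit of a non-negative bump positive at the vertex is non-zero (★ ConeValuePos ED. 3)
    have ha₀w₀ : a₀ w₀ = ⟨hypBlockGL 0 (s w₀ 0), hypBlockGL_mem_archLocal L w₀ 0 (s w₀ 0)⟩ := by
      simp only [ha₀]
      rw [endoBlockAt_eq_mk_hypBlockGL L (insert w₀ S) hw1, cayPt_apply_self]
      apply Subtype.ext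
      simp only [Matrix.cons_val_zero, Matrix.cons_val_two, Matrix.tail_cons, Matrix.head_cons]
      rw [show (s w₀ 0 + s w₀ 2) / 2 = s w₀ 0 by rw [← hs]; ring]
    have h0 : ∀ g : ↥(unitaryGroupOfForm (starRingEnd ℂ) ((Matrix.of fun i j : Fin 2 => if i.val + j.val + 1 = 2 then (1 : L) else 0).map w₀.1.embedding)), 0 ≤ (f₀ ((g : GL (Fin 2) ℂ) : Matrix (Fin 2) (Fin 2) ℂ)).re ∧ (f₀ ((g : GL (Fin 2) ℂ) : Matrix (Fin 2) (Fin 2) ℂ)).im = 0 := fun g => by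
      have h := hfw₀ g
      simp only [] at h
      rw [← h]
      exact ⟨by simpa using (hf w₀).2.2.1 g, by simp⟩
    have hz : 0 < (f₀ (((⟨hypBlockGL 0 (s w₀ 0), hypBlockGL_mem_of_eq_over hJ 0 (s w₀ 0)⟩ : ↥(unitaryGroupOfForm (starRingEnd ℂ) ((Matrix.of fun i j : Fin 2 => if i.val + j.val + 1 = 2 then (1 : L) else 0).map w₀.1.embedding))) : GL (Fin 2) ℂ) : Matrix (Fin 2) (Fin 2) ℂ)).re := by
      have h := hfw₀ ⟨hypBlockGL 0 (s w₀ 0), hypBlockGL_mem_archLocal L w₀ 0 (s w₀ 0)⟩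
      simp only [] at h
      have h1 : f w₀ ⟨hypBlockGL 0 (s w₀ 0), hypBlockGL_mem_archLocal L w₀ 0 (s w₀ 0)⟩ = 1 := by rw [← ha₀w₀]; exact (hf w₀).2.2.2
      rw [h1] at h
      rw [← h]
      simp
    have hcone : C₂ • (((∫ p in Ioi (0 : ℝ) ×ˢ Ioc (0 : ℝ) (2 * π),
                f₀ ((!![(1 : ℂ), 1; 1, -1] : Matrix (Fin 2) (Fin 2) ℂ) *
                  (((Circle.exp (s w₀ 0) : Circle) : ℂ) • (1 : Matrix (Fin 2) (Fin 2) ℂ) +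
                    p.1 • Matrix.diagonal ![((Circle.exp (s w₀ 0) : Circle) : ℂ) * I, -(((Circle.exp (s w₀ 0) : Circle) : ℂ) * I)] +
                    p.1 • !![(0 : ℂ), -(((Circle.exp (s w₀ 0) : Circle) : ℂ) * I) * cexp (-((p.2 : ℂ) * I));
                      (((Circle.exp (s w₀ 0) : Circle) : ℂ) * I) * cexp ((p.2 : ℂ) * I), 0]) *
                  !![(1 / 2 : ℂ), 1 / 2; 1 / 2, -(1 / 2)])) +
              ∫ p in Ioi (0 : ℝ) ×ˢ Ioc (0 : ℝ) (2 * π),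
                f₀ ((!![(1 : ℂ), 1; 1, -1] : Matrix (Fin 2) (Fin 2) ℂ) *
                  (((Circle.exp (s w₀ 0) : Circle) : ℂ) • (1 : Matrix (Fin 2) (Fin 2) ℂ) +
                    p.1 • Matrix.diagonal ![-(((Circle.exp (s w₀ 0) : Circle) : ℂ) * I), ((Circle.exp (s w₀ 0) : Circle) : ℂ) * I] +
                    p.1 • !![(0 : ℂ), (((Circle.exp (s w₀ 0) : Circle) : ℂ) * I) * cexp (-((p.2 : ℂ) * I));
                      -(((Circle.exp (s w₀ 0) : Circle) : ℂ) * I) * cexp ((p.2 : ℂ) * I), 0]) *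
                  !![(1 / 2 : ℂ), 1 / 2; 1 / 2, -(1 / 2)]))) ≠ 0 := by
      have h := ne_zero_of_tendsto_abs_sub_smul_integral_descConj_hypBlockGL_of_re_nonneg hJ μ₀' hμ₀'
        (F := fun g : ↥(unitaryGroupOfForm (starRingEnd ℂ) ((Matrix.of fun i j : Fin 2 => if i.val + j.val + 1 = 2 then (1 : L) else 0).map w₀.1.embedding)) => f₀ ((g : GL (Fin 2) ℂ) : Matrix (Fin 2) (Fin 2) ℂ))
        (hf₀.comp (Units.continuous_val.comp continuous_subtype_val)) (hf₀c.comp_isClosedEmbedding (isClosedEmbedding_coe_unitaryGroupOfForm _ hdet₀)) h0 (s w₀ 0) hz (l := 𝓝[≠] (0 : ℝ)) le_rfl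
        (hA0 f₀ hf₀ hf₀c (s w₀ 0))
      simpa only [← Circle.coe_exp] using h
    have hℓ₀ : (c : ℂ) * ((C₂ : ℂ) * ((∫ p in Ioi (0 : ℝ) ×ˢ Ioc (0 : ℝ) (2 * π),
                f₀ ((!![(1 : ℂ), 1; 1, -1] : Matrix (Fin 2) (Fin 2) ℂ) *
                  (((Circle.exp (s w₀ 0) : Circle) : ℂ) • (1 : Matrix (Fin 2) (Fin 2) ℂ) +
                    p.1 • Matrix.diagonal ![((Circle.exp (s w₀ 0) : Circle) : ℂ) * I, -(((Circle.exp (s w₀ 0) : Circle) : ℂ) * I)] +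
                    p.1 • !![(0 : ℂ), -(((Circle.exp (s w₀ 0) : Circle) : ℂ) * I) * cexp (-((p.2 : ℂ) * I));
                      (((Circle.exp (s w₀ 0) : Circle) : ℂ) * I) * cexp ((p.2 : ℂ) * I), 0]) *
                  !![(1 / 2 : ℂ), 1 / 2; 1 / 2, -(1 / 2)])) +
              ∫ p in Ioi (0 : ℝ) ×ˢ Ioc (0 : ℝ) (2 * π),
                f₀ ((!![(1 : ℂ), 1; 1, -1] : Matrix (Fin 2) (Fin 2) ℂ) *
                  (((Circle.exp (s w₀ 0) : Circle) : ℂ) • (1 : Matrix (Fin 2) (Fin 2) ℂ) +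
                    p.1 • Matrix.diagonal ![-(((Circle.exp (s w₀ 0) : Circle) : ℂ) * I), ((Circle.exp (s w₀ 0) : Circle) : ℂ) * I] +
                    p.1 • !![(0 : ℂ), (((Circle.exp (s w₀ 0) : Circle) : ℂ) * I) * cexp (-((p.2 : ℂ) * I));
                      -(((Circle.exp (s w₀ 0) : Circle) : ℂ) * I) * cexp ((p.2 : ℂ) * I), 0]) *
                  !![(1 / 2 : ℂ), 1 / 2; 1 / 2, -(1 / 2)]))) ≠ 0 := by
      refine mul_ne_zero (by exact_mod_cast hc) ?_
      rw [← Complex.real_smul]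
      exact hcone
    -- spectator values: ★ (N2) over the closed orbits ★ (P-cont-c∕s)
    have ha₀w : ∀ w, w ≠ w₀ → endoBlockAt L (insert w₀ S) w (s w) = a₀ w := fun w hne => by
      simp only [ha₀]; rw [cayPt_apply_of_ne hne]
    have hsplit : ∀ w ∈ S, (fun w v => chartOrbHLoc L (insert w₀ S) w (νw w) (fun x => ((f w x : ℝ) : ℂ)) v) w (s w) ≠ 0 := fun w hwS => by
      have hne : w ≠ w₀ := fun h => hw₀ (h ▸ hwS)
      refine chartOrbHLoc_ofReal_ne_zero_of_nonneg L (insert w₀ S) w (νw w) (s w) (hf w).1 (fun x => (hf w).2.2.1 x)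
        (hasCompactSupport_descConj_endoBlockAt_of_mem L (insert w₀ S) w (Finset.mem_insert_of_mem hwS) (hregS w hwS) (f w) (hf w).2.1)
        (x₀ := 1) ?_
      rw [one_mul, inv_one, mul_one, ha₀w w hne, (hf w).2.2.2]
      exact one_ne_zero
    have hcpt : ∀ w, w ∉ S → w ≠ w₀ → (fun w v => chartOrbHLoc L (insert w₀ S) w (νw w) (fun x => ((f w x : ℝ) : ℂ)) v) w (s w) + (fun w v => chartOrbHLoc L (insert w₀ S) w (νw w) (fun x => ((f w x : ℝ) : ℂ)) v) w ![s w 2, s w 1, s w 0] ≠ 0 := fun w hwS hne => by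
      have hwS' : w ∉ insert w₀ S := by rw [Finset.mem_insert, not_or]; exact ⟨hne, hwS⟩
      have h := compactFactor_chartOrbHLoc_ofReal_ne_zero_of_nonneg L (insert w₀ S) w (νw w) (s w) (hreg w hwS hne) (hf w).1 (fun x => (hf w).2.2.1 x)
        (hasCompactSupport_descConj_endoBlockAt_of_not_mem L (insert w₀ S) w hwS' (hreg w hwS hne) (f w) (hf w).2.1)
        (x₀ := 1) (by rw [one_mul, inv_one, mul_one, ha₀w w hne, (hf w).2.2.2]; exact one_ne_zero)
      exact (mul_ne_zero_iff.1 h).2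
    exact stOrbFamH_insert_cayPt_ne_zero_of_ray L νH fH hΨ S hw₀ hs hreg hregS (G := (fun c' => ((Λ : ℝ) : ℂ) * ((νB.real Set.univ : ℂ) * ((g (endoTorus L (insert w₀ S) c').2 : ℝ) : ℂ)))) (φ := (fun w v => chartOrbHLoc L (insert w₀ S) w (νw w) (fun x => ((f w x : ℝ) : ℂ)) v))
      (fun c' _ => hP (insert w₀ S) c') hG' hGt' hg₀ hA0ray hℓ₀ hsplit hcpt

end HSide

end Literature.NumberTheory.Rogawski1990

end
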